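import Summits.CriticalPhenomena.PercolationContinuityZ3.Theorems.PercNearOneGluingNoHeavyRsw3SetToSetArmVisitsGated
import Summits.CriticalPhenomena.PercolationContinuityZ3.Theorems.PercNearOneGluingNoHeavyRsw3SetToSetArmVisitsCritical
import Summits.CriticalPhenomena.PercolationContinuityZ3.Theorems.PercAnnulusCrossingIICAspectExistence
import Summits.CriticalPhenomena.PercolationContinuityZ3.Theorems.PercAnnulusCrossingIICMeasure
import HarnessLib

/-!
# RSW3 lane (P2, gen 18): KESTEN'S IIC UNDER (A2)□ VISITS AND AVOIDS EVERY MESOSCOPIC BALL — `ν(0 ↔ Λ_t(m) in Λ(‖t‖_∞)) ≥ c` and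
# `ν(0 ↔ ∂ⁱⁿΛ(R) in Λ(R) ∖ Λ_t(m)) ≥ c` for every IIC measure `ν` at `p_c(ℤ^d)`, all balls with `m ≍ ‖t‖_∞`

builds on p205010 (kernel theorem, internal audit signed; external expert review pending) — USED only by the last theorem
(`exists_iicMeasure_visits_avoids_of_setToSetQuasiMultAspectAt`, through p1's `Crossing.kestenIICExistsAt_criticalProbI_of_setToSetQuasiMultAspectAt`,
which needs `θ(p_c) = 0`); the `ν`-hypothesis forms do not use it.

Cell `prim-rsw3`, prover seat `prim-rsw3-p2` (gen 18), memo `run/shared/lean/prim/rsw3/P2-RSWLITE.md` §25.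
Support file (`--supports stmt-CriticalPhenomena-4575`); no definitions, no named facts, no sorries.

The local pre-limit bounds (`…ArmVisitsGated`, `…ArmVisitsCritical`) concern FIXED cylinder events:
`V = {{0} ↔ Λ_t(m) in Λ(‖t‖_∞)}` and `A_R = {{0} ↔ ∂ⁱⁿΛ(R) in Λ(R) ∖ Λ_t(m)}`, with `P_{p_c}(V ∩ {0 ↔ ∂Λ(n)}) ≥ c·π_{p_c}(n)` and
`P_{p_c}(A_R ∩ {0 ↔ ∂Λ(n)}) ≥ c·π_{p_c}(n)` for all large `n`.  Any measure `ν` with Kesten's limit property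
`P(E ∩ {0 ↔ ∂Λ(n)})/π(n) → ν(E)` on cylinder events (p1: `Crossing.exists_iicMeasure_of_kestenIICExistsAt`) therefore gives `ν(V) ≥ c`,
`ν(A_R) ≥ c` (`le_iicMeasure_real_visits`, `le_iicMeasure_real_avoids`): **Kesten's incipient infinite cluster on `ℤ^d` under (A2)□ meets
every mesoscopic ball near the origin with probability ≥ c(C) and sends an arm past it without touching it with probability ≥ c(C)** — no
empty and no forced sectors, uniformly over scales (planar case: RSW).  With p1's existence theorem the measure exists at `p_c(ℤ^d)`
under (A2)□ (`exists_iicMeasure_visits_avoids_of_setToSetQuasiMultAspectAt`).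

References: H. Kesten, Probab. Theory Relat. Fields 73 (1986) 369–394, Thm. (3) [Kesten1986]; D. Basu, A. Sapozhnikov, ECP 22 (2017)
no. 26, Thm. 1.1 [BasuSapozhnikov2017ECP]; G. Grimmett, *Percolation* (1999), §9.1 [GrimmettPercolation1999]. [folklore]
-/

noncomputable section

namespace Summit.CriticalPhenomena.PercolationContinuityZ3.Theorems

namespace Rsw3

open MeasureTheory Filter Topology Literature.Probability.LatticeModels Literature.Probability.Percolation
open SurfaceTension Crossing SimpleGraph

variable {d : ℕ}

/-! ## The local pre-limit bound at `p_c(ℤ^d)` -/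

/-- **(A2)□ at `p_c(ℤ^d)` ⇒ the arm visits every mesoscopic ball INSIDE `Λ(‖t‖_∞)`** (`d ≥ 2`, `2 ≤ s ≤ L`, `ϰ > 0`, any `C`): there is
`c > 0` with `c · π_{p_c}(n) ≤ P_{p_c}[{0 ↔ ∂Λ(n)} ∩ {{0} ↔ Λ_t(m) in Λ(‖t‖_∞)}]` for all `m ≥ 8(L+1)`, `m ≤ ‖t‖_∞ ≤ C m`,
`n ≥ L(‖t‖_∞ + 1) + 1` — the visit as a FIXED cylinder event. [cite: BasuSapozhnikov2017ECP, §1 assumption (A2)] [cite: Kesten1986, Thm. 3] -/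
theorem exists_mul_oneArmProb_le_real_visits_local_of_setToSetQuasiMultAspectAt (hd : 2 ≤ d) {s L : ℕ} {ϰ : ℝ}
    (h : SetToSetQuasiMultAspectAt d (criticalProbI d) s L ϰ) (hϰ : 0 < ϰ) (hs : 2 ≤ s) (hsL : s ≤ L) (C : ℕ) :
    ∃ c : ℝ, 0 < c ∧ ∀ (m : ℕ) (t : Site d) (i : Fin d) (n : ℕ), 8 * (L + 1) ≤ m →
      (∀ j, (t j).natAbs ≤ (t i).natAbs) → m ≤ (t i).natAbs → (t i).natAbs ≤ C * m →
      L * ((t i).natAbs + 1) + 1 ≤ n →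
        c * oneArmProb d (criticalProbI d) n ≤ (bondPercolation (zdGraph d) (criticalProbI d)).real
          (siteToBoundary d n ∩
            openCrossing (↑(box d (t i).natAbs) : Set (Site d)) ↑({(0 : Site d)} : Finset (Site d)) ↑(GM.ball t m)) := by
  classical
  have hd1 : 1 ≤ d := by omega
  set pc : unitInterval := criticalProbI d with hpcdef
  have hpc : 0 < (pc : ℝ) := by rw [hpcdef, coe_criticalProbI]; exact criticalProb_zd_pos d hd1
  have hdpos : (0 : ℝ) < d := by exact_mod_cast (show 0 < d by omega)
  have hd0 : (0 : ℝ) < 2 * d := by linarith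
  set u₀ : ℝ := (2 * (d : ℝ))⁻¹ * ((4 * (s : ℝ)) ^ (d - 1))⁻¹ with hu₀
  set v₀ : ℝ := (2 * (d : ℝ))⁻¹ * ((4 * ((2 * L + 2 : ℕ) : ℝ)) ^ (d - 1))⁻¹ with hv₀
  have hs0 : (0 : ℝ) < s := by exact_mod_cast (show 0 < s by omega)
  have hL0 : (0 : ℝ) < ((2 * L + 2 : ℕ) : ℝ) := by exact_mod_cast (show 0 < 2 * L + 2 by omega)
  have hu₀pos : 0 < u₀ := by positivity
  have hv₀pos : 0 < v₀ := by positivity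
  have hu : ∀ m', 1 ≤ m' → u₀ ≤ (bondPercolation (zdGraph d) pc).real (boxCrossing d m' (s * m')) :=
    fun m' hm' => le_real_boxCrossing_mul_criticalProbI hd (by omega) hm'
  have hv : ∀ m', 1 ≤ m' → v₀ ≤ (bondPercolation (zdGraph d) pc).real (boxCrossing d m' ((2 * L + 2) * m')) :=
    fun m' hm' => le_real_boxCrossing_mul_criticalProbI hd (by omega) hm'
  obtain ⟨P, hP⟩ : ∃ P : ℕ, P = 8 * (L + 1) := ⟨_, rfl⟩
  obtain ⟨K, hK⟩ : ∃ K : ℕ, K = s * (2 * C * P + 1) := ⟨_, rfl⟩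
  set c : ℝ := ϰ ^ 2 * (ϰ * u₀) ^ (K + 1) * (v₀ / (2 * d)) with hc
  have hcpos : 0 < c := by positivity
  refine ⟨c, hcpos, fun m t i n hm hmax hmN hNC hn => ?_⟩
  obtain ⟨N, hN⟩ : ∃ N : ℕ, N = (t i).natAbs := ⟨_, rfl⟩
  rw [← hN] at hmax hmN hNC hn ⊢
  obtain ⟨m', hm'⟩ : ∃ m' : ℕ, m' = m / P := ⟨_, rfl⟩
  have hP0 : 0 < P := by omega
  have hm'1 : 1 ≤ m' := by rw [hm']; exact (Nat.le_div_iff_mul_le hP0).2 (by omega)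
  have hdm := Nat.div_add_mod m P
  have hml := Nat.mod_lt m hP0
  rw [← hm'] at hdm
  have hPm' : P * m' = 8 * ((L + 1) * m') := by rw [hP]; ring
  have hL1 : (L + 1) * m' = L * m' + m' := by ring
  obtain ⟨q, hq⟩ : ∃ q : ℕ, q = (2 * L + 2) * m' := ⟨_, rfl⟩
  have hq' : q = 2 * (L * m') + 2 * m' := by rw [hq]; ring
  have h44 : (4 * L + 4) * m' = 4 * (L * m') + 4 * m' := by ring
  have hqN : q ≤ N := by omega
  obtain ⟨W, hW⟩ : ∃ W : ℕ, W = N - q := ⟨_, rfl⟩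
  have hWq : W + q = N := by omega
  obtain ⟨ε, hε⟩ : ∃ ε : ℤˣ, (ε : ℤ) * t i = ((W + q : ℕ) : ℤ) := by
    rcases le_or_gt 0 (t i) with h0 | h0
    · exact ⟨1, by rw [Units.val_one, one_mul, hWq, hN]; omega⟩
    · exact ⟨-1, by rw [Units.val_neg, Units.val_one, hWq, hN]; omega⟩
  have hCm : C * m = C * (P * m') + C * (m % P) := by rw [← Nat.mul_add, hdm]
  have hCmod : C * (m % P) ≤ C * P := Nat.mul_le_mul_left C hml.le
  have hCP1 : C * P + 1 ≤ (C * P + 1) * m' := Nat.le_mul_of_pos_right _ hm'1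
  have hW1 : W + 1 ≤ (2 * C * P + 1) * m' := by
    have h1 : (2 * C * P + 1) * m' = C * (P * m') + (C * P + 1) * m' := by ring
    rw [h1]; omega
  have hKm : s * (W + 1) ≤ K * m' := by
    rw [hK, mul_assoc]; exact Nat.mul_le_mul_left s hW1
  have hcore := mul_oneArmProb_le_oneArmProb_mul_real_visits_local hd1 h hϰ.le hs hsL t i ε (m := m) (m' := m') (q := q)
    (W := W) (n := n) (K := K) hm'1 hε (fun j => by rw [hWq]; exact hmax j) (by omega) (by omega)
    (le_trans (Nat.add_le_add_right (Nat.mul_le_mul_left L (by omega)) 1) hn) hKm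
  set μ := bondPercolation (zdGraph d) pc with hμ
  -- enlarge the box `Λ(W) ⊆ Λ(N)`
  have hmonoW : μ.real (siteToBoundary d n ∩
        openCrossing (↑(box d W) : Set (Site d)) ↑({(0 : Site d)} : Finset (Site d)) ↑(GM.ball t m)) ≤
      μ.real (siteToBoundary d n ∩
        openCrossing (↑(box d N) : Set (Site d)) ↑({(0 : Site d)} : Finset (Site d)) ↑(GM.ball t m)) :=
    measureReal_mono (Set.inter_subset_inter_right _
      (openCrossing_mono (Finset.coe_subset.2 (box_mono d (show W ≤ N by omega))) le_rfl le_rfl)) (measure_ne_top _ _)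
  have hq₁ : ϰ * u₀ ≤ ϰ * μ.real (boxCrossing d m' (s * m')) := mul_le_mul_of_nonneg_left (hu m' hm'1) hϰ.le
  have hpow : (ϰ * u₀) ^ (K + 1) ≤ (ϰ * μ.real (boxCrossing d m' (s * m'))) ^ (K + 1) :=
    pow_le_pow_left₀ (by positivity) hq₁ _
  have hv₂ : v₀ / (2 * d) ≤ μ.real (boxCrossing d m' ((2 * L + 2) * m')) / (2 * d) :=
    div_le_div_of_nonneg_right (hv m' hm'1) hd0.le
  have hπ : oneArmProb d pc (s * (W + 1)) ≤ oneArmProb d pc (s * m') :=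
    DCT16.real_siteToBoundary_antitone pc (Nat.mul_le_mul_left s (by omega))
  have hπsM : 0 < oneArmProb d pc (s * (W + 1)) :=
    (pow_pos hpc _).trans_le (DKT20.pow_le_real_siteToBoundary hd1 pc _)
  have hπn0 : 0 ≤ oneArmProb d pc n := measureReal_nonneg
  have hkey : oneArmProb d pc (s * (W + 1)) * (c * oneArmProb d pc n) ≤
      oneArmProb d pc (s * (W + 1)) * μ.real (siteToBoundary d n ∩
        openCrossing (↑(box d N) : Set (Site d)) ↑({(0 : Site d)} : Finset (Site d)) ↑(GM.ball t m)) := by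
    refine le_trans ?_ (hcore.trans (mul_le_mul_of_nonneg_left hmonoW measureReal_nonneg))
    have hQ0 : 0 ≤ (ϰ * μ.real (boxCrossing d m' (s * m'))) ^ (K + 1) :=
      pow_nonneg (mul_nonneg hϰ.le measureReal_nonneg) _
    have hA : (ϰ * u₀) ^ (K + 1) * (v₀ / (2 * d)) ≤
        (ϰ * μ.real (boxCrossing d m' (s * m'))) ^ (K + 1) * (μ.real (boxCrossing d m' ((2 * L + 2) * m')) / (2 * d)) :=
      mul_le_mul hpow hv₂ (div_nonneg hv₀pos.le hd0.le) hQ0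
    have hB : (ϰ * u₀) ^ (K + 1) * (v₀ / (2 * d)) * oneArmProb d pc (s * (W + 1)) ≤
        (ϰ * μ.real (boxCrossing d m' (s * m'))) ^ (K + 1) * (μ.real (boxCrossing d m' ((2 * L + 2) * m')) / (2 * d)) *
          oneArmProb d pc (s * m') :=
      mul_le_mul hA hπ measureReal_nonneg (mul_nonneg hQ0 (div_nonneg measureReal_nonneg hd0.le))
    have hϰπ : 0 ≤ ϰ ^ 2 * oneArmProb d pc n := mul_nonneg (pow_nonneg hϰ.le 2) hπn0
    calc oneArmProb d pc (s * (W + 1)) * (c * oneArmProb d pc n)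
        = ϰ ^ 2 * oneArmProb d pc n * ((ϰ * u₀) ^ (K + 1) * (v₀ / (2 * d)) * oneArmProb d pc (s * (W + 1))) := by
          rw [hc]; ring
      _ ≤ ϰ ^ 2 * oneArmProb d pc n * ((ϰ * μ.real (boxCrossing d m' (s * m'))) ^ (K + 1) *
            (μ.real (boxCrossing d m' ((2 * L + 2) * m')) / (2 * d)) * oneArmProb d pc (s * m')) :=
          mul_le_mul_of_nonneg_left hB hϰπ
      _ = _ := by ring
  exact le_of_mul_le_mul_left hkey hπsM

/-! ## Consequences for any IIC measure `ν` -/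

/-- **Kesten's IIC under (A2)□ VISITS every mesoscopic ball.**  Let `ν` have the IIC limit property at `p_c(ℤ^d)`
(`P_{p_c}(E ∩ {0 ↔ ∂Λ(n)})/π_{p_c}(n) → ν(E)` for cylinder events), and (A2)□ at aspect `(s,L)` (`d ≥ 2`, `2 ≤ s ≤ L`, `ϰ > 0`).  Then for
every `C` there is `c > 0` with `c ≤ ν({0} ↔ Λ_t(m) in Λ(‖t‖_∞))` for all `m ≥ 8(L+1)`, `m ≤ ‖t‖_∞ ≤ Cm`: the incipient infinite cluster
meets every mesoscopic ball near the origin with probability bounded below, uniformly in the scale ("no empty sectors").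
[cite: Kesten1986, Thm. 3] [cite: BasuSapozhnikov2017ECP, Thm. 1.1] -/
theorem le_iicMeasure_real_visits (hd : 2 ≤ d) {s L : ℕ} {ϰ : ℝ}
    (h : SetToSetQuasiMultAspectAt d (criticalProbI d) s L ϰ) (hϰ : 0 < ϰ) (hs : 2 ≤ s) (hsL : s ≤ L)
    {ν : Measure (BondConfig (Site d))}
    (hν : ∀ (F : Finset (Sym2 (Site d))) (E : Set (BondConfig (Site d))), MeasurableSet E → DeterminedBy E ↑F →
      Tendsto (fun n : ℕ => (bondPercolation (zdGraph d) (criticalProbI d)).real (E ∩ siteToBoundary d n) /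
        oneArmProb d (criticalProbI d) n) atTop (𝓝 (ν.real E)))
    (C : ℕ) :
    ∃ c : ℝ, 0 < c ∧ ∀ (m : ℕ) (t : Site d) (i : Fin d), 8 * (L + 1) ≤ m →
      (∀ j, (t j).natAbs ≤ (t i).natAbs) → m ≤ (t i).natAbs → (t i).natAbs ≤ C * m →
        c ≤ ν.real (openCrossing (↑(box d (t i).natAbs) : Set (Site d)) ↑({(0 : Site d)} : Finset (Site d)) ↑(GM.ball t m)) := by
  classical
  have hd1 : 1 ≤ d := by omega
  obtain ⟨c, hc, hvis⟩ := exists_mul_oneArmProb_le_real_visits_local_of_setToSetQuasiMultAspectAt hd h hϰ hs hsL C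
  refine ⟨c, hc, fun m t i hm hmax hmN hNC => ?_⟩
  set E : Set (BondConfig (Site d)) :=
    openCrossing (↑(box d (t i).natAbs) : Set (Site d)) ↑({(0 : Site d)} : Finset (Site d)) ↑(GM.ball t m) with hE
  have hloc : IsLocalEvent E := isLocalEvent_openCrossing _ _ _
  have hlim := tendsto_iicMeasure_of_isLocalEvent (criticalProbI d) hν hloc
  have hpc : 0 < ((criticalProbI d : unitInterval) : ℝ) := by rw [coe_criticalProbI]; exact criticalProb_zd_pos d hd1
  refine ge_of_tendsto hlim (Filter.eventually_atTop.2 ⟨L * ((t i).natAbs + 1) + 1, fun n hn => ?_⟩)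
  have hπ : 0 < oneArmProb d (criticalProbI d) n :=
    (pow_pos hpc _).trans_le (DKT20.pow_le_real_siteToBoundary hd1 (criticalProbI d) _)
  rw [le_div_iff₀ hπ, Set.inter_comm]
  exact hvis m t i n hm hmax hmN hNC hn

/-- **Kesten's IIC under (A2)□ AVOIDS every mesoscopic ball.**  With `ν` and (A2)□ as in `le_iicMeasure_real_visits`: for every `C`
there is `c > 0` with `c ≤ ν({0} ↔ ∂ⁱⁿΛ(R) in Λ(R) ∖ Λ_t(m))` for all `m ≥ 8(L+1)`, `2m ≤ ‖t‖_∞ ≤ Cm` and every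
`R ≥ L(‖t‖_∞ + m + 1) + 1` — the incipient infinite cluster contains arms to every distance avoiding any prescribed mesoscopic ball
("no forced sectors"). [cite: Kesten1986, Thm. 3] [cite: BasuSapozhnikov2017ECP, Thm. 1.1] -/
theorem le_iicMeasure_real_avoids (hd : 2 ≤ d) {s L : ℕ} {ϰ : ℝ}
    (h : SetToSetQuasiMultAspectAt d (criticalProbI d) s L ϰ) (hϰ : 0 < ϰ) (hs : 2 ≤ s) (hsL : s ≤ L)
    {ν : Measure (BondConfig (Site d))}
    (hν : ∀ (F : Finset (Sym2 (Site d))) (E : Set (BondConfig (Site d))), MeasurableSet E → DeterminedBy E ↑F →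
      Tendsto (fun n : ℕ => (bondPercolation (zdGraph d) (criticalProbI d)).real (E ∩ siteToBoundary d n) /
        oneArmProb d (criticalProbI d) n) atTop (𝓝 (ν.real E)))
    (C : ℕ) :
    ∃ c : ℝ, 0 < c ∧ ∀ (m : ℕ) (t : Site d) (i : Fin d) (R : ℕ), 8 * (L + 1) ≤ m →
      (∀ j, (t j).natAbs ≤ (t i).natAbs) → 2 * m ≤ (t i).natAbs → (t i).natAbs ≤ C * m →
      L * ((t i).natAbs + m + 1) + 1 ≤ R →
        c ≤ ν.real (openCrossing (↑(box d R \ GM.ball t m) : Set (Site d)) ↑({(0 : Site d)} : Finset (Site d))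
          ↑(innerBoundary (zdGraph d) (box d R))) := by
  classical
  have hd1 : 1 ≤ d := by omega
  obtain ⟨c, hc, hav⟩ := exists_mul_oneArmProb_le_real_avoids_of_setToSetQuasiMultAspectAt hd h hϰ hs hsL C
  refine ⟨c, hc, fun m t i R hm hmax hmN hNC hR => ?_⟩
  set E : Set (BondConfig (Site d)) := openCrossing (↑(box d R \ GM.ball t m) : Set (Site d))
    ↑({(0 : Site d)} : Finset (Site d)) ↑(innerBoundary (zdGraph d) (box d R)) with hE
  have hloc : IsLocalEvent E := isLocalEvent_openCrossing _ _ _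
  have hlim := tendsto_iicMeasure_of_isLocalEvent (criticalProbI d) hν hloc
  have hpc : 0 < ((criticalProbI d : unitInterval) : ℝ) := by rw [coe_criticalProbI]; exact criticalProb_zd_pos d hd1
  refine ge_of_tendsto hlim (Filter.eventually_atTop.2 ⟨R, fun n hn => ?_⟩)
  have hπ : 0 < oneArmProb d (criticalProbI d) n :=
    (pow_pos hpc _).trans_le (DKT20.pow_le_real_siteToBoundary hd1 (criticalProbI d) _)
  rw [le_div_iff₀ hπ]
  refine (hav m t i n hm hmax hmN hNC (hR.trans hn)).trans ?_
  refine DCT16.real_mono_of_forall_subset_edgeSet (zdGraph d) (criticalProbI d) fun ω hω hmem => ⟨?_, ?_⟩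
  · exact openCrossing_sdiff_subset_of_le hn (GM.ball t m) hω hmem
  · exact openCrossing_zero_subset_siteToBoundary Finset.sdiff_subset hmem

/-! ## At `p_c(ℤ^d)` the IIC measure exists under (A2)□ (p1), so both bounds hold for it -/

/-- **(A2)□ at `p_c(ℤ^d)` ⇒ an IIC probability measure exists and it VISITS and AVOIDS every mesoscopic ball** (`d ≥ 2`, `2 ≤ s ≤ L`,
`ϰ > 0`): existence is p1's `Crossing.kestenIICExistsAt_criticalProbI_of_setToSetQuasiMultAspectAt` (Basu–Sapozhnikov Thm. 1.1 in box form,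
uses `θ(p_c) = 0`, p205010) + `Crossing.exists_iicMeasure_of_kestenIICExistsAt`; the bounds are `le_iicMeasure_real_visits` /
`le_iicMeasure_real_avoids`. [cite: BasuSapozhnikov2017ECP, Thm. 1.1] [cite: Kesten1986, Thm. 3] -/
theorem exists_iicMeasure_visits_avoids_of_setToSetQuasiMultAspectAt (hd : 2 ≤ d) {s L : ℕ} {ϰ : ℝ}
    (h : SetToSetQuasiMultAspectAt d (criticalProbI d) s L ϰ) (hϰ : 0 < ϰ) (hs : 2 ≤ s) (hsL : s ≤ L) (C : ℕ) :
    ∃ ν : Measure (BondConfig (Site d)), IsProbabilityMeasure ν ∧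
      (∀ (F : Finset (Sym2 (Site d))) (E : Set (BondConfig (Site d))), MeasurableSet E → DeterminedBy E ↑F →
        Tendsto (fun n : ℕ => (bondPercolation (zdGraph d) (criticalProbI d)).real (E ∩ siteToBoundary d n) /
          oneArmProb d (criticalProbI d) n) atTop (𝓝 (ν.real E))) ∧
      ∃ c : ℝ, 0 < c ∧
        (∀ (m : ℕ) (t : Site d) (i : Fin d), 8 * (L + 1) ≤ m → (∀ j, (t j).natAbs ≤ (t i).natAbs) → m ≤ (t i).natAbs →
          (t i).natAbs ≤ C * m →
            c ≤ ν.real (openCrossing (↑(box d (t i).natAbs) : Set (Site d)) ↑({(0 : Site d)} : Finset (Site d)) ↑(GM.ball t m))) ∧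
        (∀ (m : ℕ) (t : Site d) (i : Fin d) (R : ℕ), 8 * (L + 1) ≤ m → (∀ j, (t j).natAbs ≤ (t i).natAbs) →
          2 * m ≤ (t i).natAbs → (t i).natAbs ≤ C * m → L * ((t i).natAbs + m + 1) + 1 ≤ R →
            c ≤ ν.real (openCrossing (↑(box d R \ GM.ball t m) : Set (Site d)) ↑({(0 : Site d)} : Finset (Site d))
              ↑(innerBoundary (zdGraph d) (box d R)))) := by
  have hd1 : 1 ≤ d := by omega
  have hpc : 0 < ((criticalProbI d : unitInterval) : ℝ) := by rw [coe_criticalProbI]; exact criticalProb_zd_pos d hd1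
  have hex := kestenIICExistsAt_criticalProbI_of_setToSetQuasiMultAspectAt hd hs hϰ h
  obtain ⟨ν, hνprob, hν⟩ := exists_iicMeasure_of_kestenIICExistsAt hd1 (criticalProbI d) hpc hex
  obtain ⟨c₁, hc₁, h₁⟩ := le_iicMeasure_real_visits hd h hϰ hs hsL hν C
  obtain ⟨c₂, hc₂, h₂⟩ := le_iicMeasure_real_avoids hd h hϰ hs hsL hν C
  refine ⟨ν, hνprob, hν, min c₁ c₂, lt_min hc₁ hc₂, fun m t i hm hmax hmN hNC => ?_, fun m t i R hm hmax hmN hNC hR => ?_⟩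
  · exact (min_le_left _ _).trans (h₁ m t i hm hmax hmN hNC)
  · exact (min_le_right _ _).trans (h₂ m t i R hm hmax hmN hNC hR)

end Rsw3

end Summit.CriticalPhenomena.PercolationContinuityZ3.Theorems
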